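import Summits.AnomalousDissipation.AnomalousDissipation.Theorems.SolenoidalFractalHomogenisationLagrangianStepVmodIterProp
import Summits.AnomalousDissipation.AnomalousDissipation.Theorems.SolenoidalFractalHomogenisationLagrangianStepVmodFastModeGenerator
import HarnessLib

/-!
# K1L_D (stmt-AnomalousDissipation-27980): (V_mod) flat stage, block (fs) — THE HEAD-WINDOW REDUCTION (general carrier phase ⟶ grid point)
# for the slow leak of a fast class datum (item (b) «general phase» of D28-5, coarse classes)
(helper; `--supports 27980 --as helper`; prover ad-k1loc-p3 g10.)

A window `[s,t]` at an arbitrary carrier phase is cut at an intermediate time `s₁ ∈ [s,t]` (the assembler takes the first grid point after `s`).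
By the cocycle `U(s,t)v = U(s₁,t)z` with `z = U(s,s₁)v`; `z` stays in the class pair of `ℓ` (class preservation) and splits into its real
pair `a` at `±ℓ` and its fast part `f` (`exists_pair_split`).  The pair amplitude is the HEAD LEAK `‖𝓕z(ℓ)‖ ≤ εh·‖v‖`,
`εh = min 1 ((s₁−s)·A·|ℓ|)` (generator bound `norm_fc_apply_le_of_fast`, valid at ANY phase, and contraction), and `‖f‖ ≤ ‖v‖`.  Hence

  `‖𝓕(U s t v)(ℓ)‖ ≤ ‖𝓕(T(s₁,t)a)(ℓ)‖ + ‖𝓕((U−T)(s₁,t)a)(ℓ)‖ + ‖𝓕(U(s₁,t)f)(ℓ)‖ ≤ ((θ′ + B_P)·εh + B_F)·‖v‖`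

(`norm_fc_le_of_head_reduction`) for ANY bounds `B_P` on the pair defect from `s₁` (the (ss) rows of `…VmodSSRegimes*`, which want `s₁ ∈ Pℕ`),
`B_F` on the fast leak from `s₁` (the (fs) rows `…VmodFsMidRow`, `…VmodFsIterRow`), and the free coarse decay `θ′ = exp(−4π²·loT·|ℓ|²·(t−s₁))`
of the pair under `T`.  So the (fs) rows at a general phase cost one head factor `εh ≤ 1` and the (ss) rows — no new analytic input.
`sorry`-free; NOT a proof of (fs), of the stub, of K1L_D or of AD; rung F-D1.A0.
-/

set_option linter.dupNamespace false

noncomputable section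

namespace Summit.AnomalousDissipation.AnomalousDissipation.Theorems.SolenoidalFractalHomogenisation.LagrangianStep.VmodGen

open Set MeasureTheory Complex UnitAddTorus
open scoped InnerProductSpace ENNReal
open Literature.Analysis Literature.Analysis.FunctionSpaces Literature.Analysis.FunctionSpaces.Torus
open Literature.Analysis.FluidPDE Literature.Analysis.FluidPDE.Torus Literature.Analysis.FluidPDE.LatticeShear
open Summit.AnomalousDissipation.AnomalousDissipation.Theorems.SolenoidalFractalHomogenisation.LagrangianStep.VmodFlat
  (fc fc_sub loT norm_sq_fcoeff_carrierFree_decay IsFast norm_fc_apply_le_of_fast)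
open Summit.AnomalousDissipation.AnomalousDissipation.Theorems.SolenoidalFractalHomogenisation.RealisedQuasiStaticCellLaw
  (isSmooth_cell isDivFree_cell memLp_top_stLift_cell)

section Clause

variable {k : ℕ} {W : LatticeWord k} {M : ℝ} {hM : 0 < M} {c : ℝ}
  {Φ : ℝ → Visc4 (Fin 3) → Visc4 (Fin 3)} {lo hi Λ β ν₀ : ℝ}
  {ν : ℝ} {n : ℕ} {𝔸 : Visc4 (Fin 3)} {Tw : ℝ} {U T : ℝ → ℝ → (V2 →L[ℝ] V2)}

set_option maxHeartbeats 1600000 in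
/-- **THE HEAD-WINDOW REDUCTION.**  See the module docstring: for a FAST member `v ∈ V2` of the class pair of a slow label
`ℓ ∈ freqBall(n/4)`, `ℓ ≠ 0`, an intermediate time `s ≤ s₁ ≤ t`, a bound `B_P` for the pair defect `‖𝓕((U−T)(s₁,t)a)(ℓ)‖ ≤ B_P‖𝓕a(ℓ)‖` on
real pair data at `±ℓ`, and a bound `B_F` for the fast leak `‖𝓕(U(s₁,t)f)(ℓ)‖ ≤ B_F‖f‖` on fast members of the class pair:
`‖𝓕(U s t v)(ℓ)‖ ≤ ((exp(−4π²·loT·|ℓ|²·(t−s₁)) + B_P)·min 1 ((s₁−s)·A·√|ℓ|²) + B_F)·‖v‖`, `A` the generator constant of `norm_fc_apply_le_of_fast`. -/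
theorem norm_fc_le_of_head_reduction (hlo : 0 < lo) (hhi : 0 ≤ hi) (hΛ : 1 ≤ Λ) (hβ : 0 ≤ β) (hc : 0 ≤ c)
    (hν : ν ∈ Set.Ioo 0 ν₀) (hn : 1 ≤ n) (hodd : OddSmall 𝔸 (ν * β))
    (hwin : ∃ lam ∈ Set.Icc (1:ℝ) Λ, NearIso 𝔸 (ν * (lo / lam)) (ν * (hi * lam)))
    (hΦw : ∃ lam ∈ Set.Icc (1:ℝ) Λ, NearIso (Φ ν ((1 / ν) • 𝔸)) (lo / lam) (hi * lam))
    (hU : IsPropagator Tw (cellField W M hM ν hν.1 n) ((1 / (n:ℝ) ^ 2) • 𝔸) U)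
    (hT : IsPropagator Tw (fun (_ : ℝ) (_ : UnitAddTorus (Fin 3)) => (0 : EuclideanSpace ℝ (Fin 3)))
      ((1 / (n:ℝ) ^ 2) • (𝔸 + (c / ν) • Φ ν ((1 / ν) • 𝔸))) T)
    {s s₁ t : ℝ} (hs : 0 ≤ s) (hss₁ : s ≤ s₁) (hs₁t : s₁ ≤ t) (htT : t ≤ Tw)
    {ℓ : Fin 3 → ℤ} (hℓ0 : ℓ ≠ 0) (hℓball : ℓ ∈ Torus.freqBall (d := Fin 3) (n / 4))
    (v : V2)
    (hvcl : ∀ k', fc v k' ≠ 0 → (∀ i, (n : ℤ) ∣ k' i - ℓ i) ∨ (∀ i, (n : ℤ) ∣ k' i + ℓ i))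
    (hv1 : fc v ℓ = 0) (hv2 : fc v (-ℓ) = 0)
    {BP BF : ℝ} (hBP : 0 ≤ BP) (hBF : 0 ≤ BF)
    (hP : ∀ a : V2, a ∈ divFreeL2 (Fin 3) → (∀ k', k' ≠ ℓ → k' ≠ -ℓ → fc a k' = 0) →
      ‖fc (U s₁ t a - T s₁ t a) ℓ‖ ≤ BP * ‖fc a ℓ‖)
    (hF : ∀ f : V2, f ∈ divFreeL2 (Fin 3) → (∀ k', fc f k' ≠ 0 → (∀ i, (n : ℤ) ∣ k' i - ℓ i) ∨ (∀ i, (n : ℤ) ∣ k' i + ℓ i)) →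
      fc f ℓ = 0 → fc f (-ℓ) = 0 → ‖fc (U s₁ t f) ℓ‖ ≤ BF * ‖f‖) :
    ‖fc (U s t v) ℓ‖
      ≤ ((Real.exp (-(4 * Real.pi ^ 2 * loT lo Λ c ν n * Torus.freqNormSq ℓ * (t - s₁))) + BP)
            * min 1 ((s₁ - s) * (6 * Real.pi * ((k:ℝ) / (2 * Real.pi * (n:ℝ))) +
                4 * Real.pi ^ 2 * ((1 / (n:ℝ) ^ 2) * (ν * (hi * Λ)) + (1 / (n:ℝ) ^ 2) * (ν * β) / 2) * ((n / 4 : ℕ) : ℝ))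
                * Real.sqrt (Torus.freqNormSq ℓ))
          + BF) * ‖v‖ := by
  classical
  -- ### scalars and windows
  have hnpos : 0 < n := hn
  have hn0 : (0:ℝ) < n := by exact_mod_cast hnpos
  have hn2 : (0:ℝ) < 1 / (n:ℝ) ^ 2 := by positivity
  have hΛ0 : 0 < Λ := lt_of_lt_of_le one_pos hΛ
  have hcν : 0 ≤ c / ν := div_nonneg hc hν.1.le
  have hloA : 0 < ν * (lo / Λ) := mul_pos hν.1 (div_pos hlo hΛ0)
  have hs₁0 : 0 ≤ s₁ := hs.trans hss₁
  have hs₁T : s₁ ≤ Tw := hs₁t.trans htT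
  have hLN : 2 * (n / 4) < n := by omega
  have hAΛ : NearIso 𝔸 (ν * (lo / Λ)) (ν * (hi * Λ)) := by
    obtain ⟨lam, hlam, hA⟩ := hwin
    have hlam1 : 0 < lam := lt_of_lt_of_le one_pos hlam.1
    exact hA.mono (mul_le_mul_of_nonneg_left (div_le_div_of_nonneg_left hlo.le hlam1 hlam.2) hν.1.le)
      (mul_le_mul_of_nonneg_left (mul_le_mul_of_nonneg_left hlam.2 hhi) hν.1.le)
  obtain ⟨lam, hlam, hA⟩ := hwin
  obtain ⟨lam', hlam', hΦn⟩ := hΦw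
  have hlam0 : 0 < lam := lt_of_lt_of_le one_pos hlam.1
  have hlam'0 : 0 < lam' := lt_of_lt_of_le one_pos hlam'.1
  have hcoarse0 : NearIso ((1 / (n:ℝ) ^ 2) • (𝔸 + (c / ν) • Φ ν ((1 / ν) • 𝔸)))
      ((1 / (n:ℝ) ^ 2) * (ν * (lo / lam) + (c / ν) * (lo / lam'))) ((1 / (n:ℝ) ^ 2) * (ν * (hi * lam) + (c / ν) * (hi * lam'))) :=
    (hA.add (hΦn.smul hcν)).smul hn2.le
  have hloT_le : loT lo Λ c ν n ≤ (1 / (n:ℝ) ^ 2) * (ν * (lo / lam) + (c / ν) * (lo / lam')) := by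
    unfold loT
    have h1 : lo / Λ ≤ lo / lam := div_le_div_of_nonneg_left hlo.le hlam0 hlam.2
    have h2 : lo / Λ ≤ lo / lam' := div_le_div_of_nonneg_left hlo.le hlam'0 hlam'.2
    have h3 : (ν + c / ν) * (lo / Λ) ≤ ν * (lo / lam) + (c / ν) * (lo / lam') := by
      have := mul_le_mul_of_nonneg_left h1 hν.1.le
      have := mul_le_mul_of_nonneg_left h2 hcν
      nlinarith
    exact mul_le_mul_of_nonneg_left h3 hn2.le
  have hloT : 0 < loT lo Λ c ν n := by
    unfold loT
    have hνc : 0 < ν + c / ν := by have := hν.1; positivity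
    exact mul_pos hn2 (mul_pos hνc (div_pos hlo hΛ0))
  have hcoarse : NearIso ((1 / (n:ℝ) ^ 2) • (𝔸 + (c / ν) • Φ ν ((1 / ν) • 𝔸)))
      (loT lo Λ c ν n) ((1 / (n:ℝ) ^ 2) * (ν * (hi * lam) + (c / ν) * (hi * lam'))) := hcoarse0.mono hloT_le le_rfl
  -- ### class-pair preservation along the head window
  set CP : V2 → Prop := fun y => ∀ k', fc y k' ≠ 0 → (∀ i, (n : ℤ) ∣ k' i - ℓ i) ∨ (∀ i, (n : ℤ) ∣ k' i + ℓ i) with hCP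
  have hbU : MemLp (FunctionSpaces.Torus.stLift (cellField W M hM ν hν.1 n)) ∞
      (volume.restrict (Ioo 0 Tw ×ˢ (univ : Set (EuclideanSpace ℝ (Fin 3))))) := memLp_top_stLift_cell _ n Tw
  have hbUdiv : ∀ᵐ τ ∂(volume.restrict (Ioo (0:ℝ) Tw)), FunctionSpaces.Torus.IsWeaklyDivFree (cellField W M hM ν hν.1 n τ) :=
    ae_of_all _ fun τ => (isDivFree_cell _ n τ).isWeaklyDivFree_holds (isSmooth_cell _ n τ)
  have hgridsp : ∀ (jj : Fin 3 → Fin n) (τ : ℝ) (y : UnitAddTorus (Fin 3)),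
      cellField W M hM ν hν.1 n τ (y + (fun i => ((((jj i : ℕ) : ℝ) / n : ℝ) : UnitAddCircle))) = cellField W M hM ν hν.1 n τ y :=
    fun jj τ y => by unfold cellField; exact cell_add_grid _ hnpos jj τ y
  have hcellN : NearIso ((1 / (n:ℝ) ^ 2) • 𝔸) ((1 / (n:ℝ) ^ 2) * (ν * (lo / Λ))) ((1 / (n:ℝ) ^ 2) * (ν * (hi * Λ))) := hAΛ.smul hn2.le
  have hcellN_lo : 0 < (1 / (n:ℝ) ^ 2) * (ν * (lo / Λ)) := by positivity
  have hUcl : ∀ s' t', 0 ≤ s' → s' ≤ t' → t' ≤ Tw → ∀ y : V2, CP y → CP (U s' t' y) := by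
    intro s' t' hs' hst' ht'T y hy k' hk'
    by_contra hnot
    have hyv : ∀ k'', ((∀ i, (n:ℤ) ∣ k'' i - k' i) ∨ (∀ i, (n:ℤ) ∣ k'' i + k' i)) → fc y k'' = 0 := by
      intro k'' hk''
      by_contra hne0
      have hcl := hy k'' hne0
      apply hnot
      rcases hk'' with h1 | h1 <;> rcases hcl with h2 | h2
      · left; intro i; have := dvd_sub (h2 i) (h1 i); rwa [show k'' i - ℓ i - (k'' i - k' i) = k' i - ℓ i by ring] at this
      · right; intro i; have := dvd_sub (h2 i) (h1 i); rwa [show k'' i + ℓ i - (k'' i - k' i) = k' i + ℓ i by ring] at this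
      · right; intro i; have := dvd_sub (h1 i) (h2 i); rwa [show k'' i + k' i - (k'' i - ℓ i) = k' i + ℓ i by ring] at this
      · left; intro i; have := dvd_sub (h1 i) (h2 i); rwa [show k'' i + k' i - (k'' i + ℓ i) = k' i - ℓ i by ring] at this
    have h0 := PropagatorSymm.fcoeff_apply_eq_zero_of_classes hU hcellN hcellN_lo hbU hbUdiv hnpos hgridsp k' hs' hst' ht'T y hyv k'
      (Or.inl fun i => by rw [sub_self]; exact dvd_zero _)
    exact hk' h0
  -- ### the state at `s₁` and its pair split
  set z : V2 := U s s₁ v with hz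
  have hzdf : z ∈ divFreeL2 (Fin 3) := (mem_divFreeL2_iff _).2 (hU.divFree s s₁ v)
  have hCPz : CP z := hUcl s s₁ hs hss₁ hs₁T v hvcl
  have hzn : ‖z‖ ≤ ‖v‖ := hU.norm_le s s₁ v
  obtain ⟨a, f, hzaf, hadf, hfdf, haoff, haℓ, -, hf1, hf2, hfoff, -, hnf⟩ := exists_pair_split hℓ0 z hzdf
  have hCPf : CP f := by
    intro k' hk'
    by_cases h1 : k' = ℓ
    · rw [h1] at hk'; exact absurd hf1 hk'
    · by_cases h2 : k' = -ℓ
      · rw [h2] at hk'; exact absurd hf2 hk'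
      · rw [hfoff k' h1 h2] at hk'; exact hCPz k' hk'
  have hfn : ‖f‖ ≤ ‖v‖ := by
    have h1 : ‖f‖ ^ 2 ≤ ‖z‖ ^ 2 := by rw [hnf]; nlinarith [sq_nonneg ‖fc z ℓ‖, sq_nonneg ‖fc z (-ℓ)‖]
    exact ((pow_le_pow_iff_left₀ (norm_nonneg _) (norm_nonneg _) two_ne_zero).1 h1).trans hzn
  -- ### the head leak `‖𝓕z(ℓ)‖ ≤ εh‖v‖` (generator at any phase, and the trivial bound)
  set A : ℝ := 6 * Real.pi * ((k:ℝ) / (2 * Real.pi * (n:ℝ))) +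
      4 * Real.pi ^ 2 * ((1 / (n:ℝ) ^ 2) * (ν * (hi * Λ)) + (1 / (n:ℝ) ^ 2) * (ν * β) / 2) * ((n / 4 : ℕ) : ℝ) with hAdef
  have hν0 : 0 < ν := hν.1
  have hA0 : 0 ≤ A := by positivity
  have hvfast : IsFast n v := by
    intro k' hk'
    by_cases hcp : (∀ i, (n:ℤ) ∣ k' i - ℓ i) ∨ (∀ i, (n:ℤ) ∣ k' i + ℓ i)
    · rcases FlatWindow.alone_of_lt hLN hℓball hk' hcp with h | h
      · rw [h]; exact hv1
      · rw [h]; exact hv2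
    · by_contra hne; exact hcp (hvcl k' hne)
  have hgen : ‖fc z ℓ‖ ≤ (s₁ - s) * A * Real.sqrt (Torus.freqNormSq ℓ) * ‖v‖ := by
    rw [hz, hAdef]
    exact norm_fc_apply_le_of_fast W M hM hlo hhi hΛ hβ hν.1 hnpos hodd ⟨lam, hlam, hA⟩ hU hs hss₁ hs₁T v hvfast hℓball
  have htriv : ‖fc z ℓ‖ ≤ 1 * ‖v‖ := by
    rw [one_mul]
    have hB := sum_norm_sq_fcoeff_le {ℓ} z
    rw [Finset.sum_singleton] at hB
    have h2 : ‖fc z ℓ‖ ≤ ‖z‖ := by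
      calc ‖fc z ℓ‖ = Real.sqrt (‖fc z ℓ‖ ^ 2) := (Real.sqrt_sq (norm_nonneg _)).symm
        _ ≤ Real.sqrt (‖z‖ ^ 2) := Real.sqrt_le_sqrt hB
        _ = ‖z‖ := Real.sqrt_sq (norm_nonneg _)
    exact h2.trans hzn
  have hhead : ‖fc z ℓ‖ ≤ min 1 ((s₁ - s) * A * Real.sqrt (Torus.freqNormSq ℓ)) * ‖v‖ := by
    rw [min_mul_of_nonneg _ _ (norm_nonneg v)]; exact le_min htriv hgen
  have hs₁s : 0 ≤ s₁ - s := by linarith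
  have hεh0 : 0 ≤ min 1 ((s₁ - s) * A * Real.sqrt (Torus.freqNormSq ℓ)) :=
    le_min zero_le_one (mul_nonneg (mul_nonneg hs₁s hA0) (Real.sqrt_nonneg _))
  -- ### the free coarse decay of the pair from `s₁`
  have haℓn : ‖fc a ℓ‖ = ‖fc z ℓ‖ := by rw [haℓ]
  have hTdec : ‖fc (T s₁ t a) ℓ‖ ≤ Real.exp (-(4 * Real.pi ^ 2 * loT lo Λ c ν n * Torus.freqNormSq ℓ * (t - s₁))) * ‖fc a ℓ‖ := by
    rcases eq_or_lt_of_le hs₁T with heq | hs₁T'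
    · have ht : t = s₁ := le_antisymm (heq ▸ htT) hs₁t
      rw [ht, hT.self_of_divFree s₁ hs₁0 heq.le a ((mem_divFreeL2_iff a).1 hadf), sub_self, mul_zero, neg_zero, Real.exp_zero, one_mul]
    · have h1 := norm_sq_fcoeff_carrierFree_decay hcoarse hloT hT hs₁0 hs₁t htT hs₁T' a ((mem_divFreeL2_iff a).1 hadf) ℓ
      have h2 : Real.exp (-(8 * Real.pi ^ 2 * loT lo Λ c ν n * Torus.freqNormSq ℓ * (t - s₁))) * ‖fc a ℓ‖ ^ 2 =
          (Real.exp (-(4 * Real.pi ^ 2 * loT lo Λ c ν n * Torus.freqNormSq ℓ * (t - s₁))) * ‖fc a ℓ‖) ^ 2 := by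
        rw [mul_pow, ← Real.exp_nat_mul]; congr 2; push_cast; ring
      rw [h2] at h1
      exact (pow_le_pow_iff_left₀ (norm_nonneg _) (by positivity) two_ne_zero).1 h1
  -- ### assembling through the cocycle
  have hcomp : U s t v = U s₁ t z := by rw [hz, hU.comp s s₁ t hs hss₁ hs₁t htT v]
  have hsplit : fc (U s t v) ℓ = fc (T s₁ t a) ℓ + fc (U s₁ t a - T s₁ t a) ℓ + fc (U s₁ t f) ℓ := by
    rw [hcomp, hzaf, map_add, fc_add, fc_sub]; abel
  set θ' : ℝ := Real.exp (-(4 * Real.pi ^ 2 * loT lo Λ c ν n * Torus.freqNormSq ℓ * (t - s₁))) with hθ'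
  set εh : ℝ := min 1 ((s₁ - s) * A * Real.sqrt (Torus.freqNormSq ℓ)) with hεh
  have e1 : ‖fc (T s₁ t a) ℓ‖ ≤ θ' * (εh * ‖v‖) :=
    hTdec.trans (by rw [haℓn]; exact mul_le_mul_of_nonneg_left hhead (Real.exp_pos _).le)
  have e2 : ‖fc (U s₁ t a - T s₁ t a) ℓ‖ ≤ BP * (εh * ‖v‖) :=
    (hP a hadf haoff).trans (by rw [haℓn]; exact mul_le_mul_of_nonneg_left hhead hBP)
  have e3 : ‖fc (U s₁ t f) ℓ‖ ≤ BF * ‖v‖ := (hF f hfdf hCPf hf1 hf2).trans (mul_le_mul_of_nonneg_left hfn hBF)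
  rw [hsplit]
  calc ‖fc (T s₁ t a) ℓ + fc (U s₁ t a - T s₁ t a) ℓ + fc (U s₁ t f) ℓ‖
      ≤ ‖fc (T s₁ t a) ℓ‖ + ‖fc (U s₁ t a - T s₁ t a) ℓ‖ + ‖fc (U s₁ t f) ℓ‖ := norm_add₃_le
    _ ≤ θ' * (εh * ‖v‖) + BP * (εh * ‖v‖) + BF * ‖v‖ := add_le_add (add_le_add e1 e2) e3
    _ = ((θ' + BP) * εh + BF) * ‖v‖ := by ring

end Clause

end Summit.AnomalousDissipation.AnomalousDissipation.Theorems.SolenoidalFractalHomogenisation.LagrangianStep.VmodGen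

end
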